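import Mathlib

/-!
# `GL_n(F)` is doubly transitive on lines: the line stabiliser `P` has two orbits on `G ⧸ P`

Group-theoretic half of the UNCONDITIONAL budget lemma for the crux `SubgroupIdentityDesigns`
(stmt-MatrixMultiplication-14079, route `LevelGradedCohnUmans`; BLOCK-SLICES Lemma 2.1 at `k = 1`):
companion files `LineStabilizerCharacter` (the permutation character `θ = Ind_P^G 1` has `⟨θ, θ⟩ = 2`,
so `θ − 1` is an irreducible character of degree `[G : P] − 1`) and `BlockSliceBudgetOne` (it has level
`≤ 1` and degree `≥ p^{n-1}`, discharging the hypothesis of `BlockSliceConditional.not_budget_lt_of_slice_eps`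
at `k = 1`).  VALUE = theorem, NOT summit progress.

For a field `F`, `G = GL_n(F)` and a coordinate `i₀`:
* `exists_GL_pair` — `G` is transitive on linearly independent PAIRS of vectors (extend both pairs to bases);
* `lineStab i₀ = P = {g : g e_{i₀} ∈ F e_{i₀}}` (a subgroup; `g ∉ P ↔ (e_{i₀}, g e_{i₀})` independent);
* `exists_smul_eq` — `P` is transitive on the cosets `gP ≠ P`, `orbit_eq` — its orbit through any `q ≠ P`
  is `{q' ≠ P}`; `sum_card_fixed` — for `n ≥ 2`, `∑_{h ∈ P} #{q ∈ G/P : h q = q} = 2 |P|` (Burnside count: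
  two `P`-orbits, i.e. two `(P, P)`-double cosets).
-/

set_option linter.dupNamespace false

open scoped Matrix
open MulAction

namespace Summit.MatrixMultiplication.MatrixMultiplication.Theorems.SubgroupIdentityDesigns.Negative
namespace LineStabilizer

variable {F : Type} [Field F] {n : ℕ}

local notation "Mat" => Matrix (Fin n) (Fin n) F

/-! ## Invertible matrices as maps -/

/-- `g x = y ↔ x = g⁻¹ y`. -/
theorem mulVec_eq_iff (g : GL (Fin n) F) (x y : Fin n → F) :
    (g : Mat) *ᵥ x = y ↔ x = ((g⁻¹ : GL (Fin n) F) : Mat) *ᵥ y := by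
  constructor
  · rintro rfl
    rw [Matrix.mulVec_mulVec, Units.inv_mul, Matrix.one_mulVec]
  · rintro rfl
    rw [Matrix.mulVec_mulVec, Units.mul_inv, Matrix.one_mulVec]

/-- `g⁻¹ (g x) = x`. -/
theorem inv_mulVec_mulVec (g : GL (Fin n) F) (x : Fin n → F) :
    ((g⁻¹ : GL (Fin n) F) : Mat) *ᵥ ((g : Mat) *ᵥ x) = x :=
  ((mulVec_eq_iff g x _).mp rfl).symm

/-- Every linear automorphism of `F^n` is given by an invertible matrix. -/
theorem exists_GL_of_linearEquiv (L : (Fin n → F) ≃ₗ[F] (Fin n → F)) :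
    ∃ g : GL (Fin n) F, ∀ x, (g : Mat) *ᵥ x = L x := by
  have h1 : (L : (Fin n → F) →ₗ[F] (Fin n → F)) ∘ₗ (L.symm : (Fin n → F) →ₗ[F] (Fin n → F)) =
      LinearMap.id := LinearMap.ext fun x => by simp
  have h2 : (L.symm : (Fin n → F) →ₗ[F] (Fin n → F)) ∘ₗ (L : (Fin n → F) →ₗ[F] (Fin n → F)) =
      LinearMap.id := LinearMap.ext fun x => by simp
  refine ⟨⟨LinearMap.toMatrix' (L : (Fin n → F) →ₗ[F] (Fin n → F)),
    LinearMap.toMatrix' (L.symm : (Fin n → F) →ₗ[F] (Fin n → F)), ?_, ?_⟩, fun x => ?_⟩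
  · rw [← LinearMap.toMatrix'_comp, h1, LinearMap.toMatrix'_id]
  · rw [← LinearMap.toMatrix'_comp, h2, LinearMap.toMatrix'_id]
  · show LinearMap.toMatrix' (L : (Fin n → F) →ₗ[F] (Fin n → F)) *ᵥ x = L x
    rw [← Matrix.toLin'_apply, Matrix.toLin'_toMatrix']
    rfl

/-- **`GL_n(F)` is transitive on linearly independent pairs**: independent `(v, w)` and `(v', w')`
are related by some `g ∈ GL_n(F)`.  (Extend both pairs to bases and match the bases.) -/
theorem exists_GL_pair [Fintype F] {v w v' w' : Fin n → F} (h : LinearIndependent F ![v, w])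
    (h' : LinearIndependent F ![v', w']) :
    ∃ g : GL (Fin n) F, (g : Mat) *ᵥ v = v' ∧ (g : Mat) *ᵥ w = w' := by
  classical
  have hvw : v ≠ w := fun e => by
    have := h.injective.ne (show (0 : Fin 2) ≠ 1 by decide)
    exact this (by simpa using e)
  have hvw' : v' ≠ w' := fun e => by
    have := h'.injective.ne (show (0 : Fin 2) ≠ 1 by decide)
    exact this (by simpa using e)
  have hs : LinearIndepOn F id (Set.range ![v, w]) := h.linearIndepOn_id
  have hs' : LinearIndepOn F id (Set.range ![v', w']) := h'.linearIndepOn_id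
  let b := Module.Basis.extend hs
  let b' := Module.Basis.extend hs'
  have hv : v ∈ hs.extend (Set.subset_univ _) := Module.Basis.subset_extend hs ⟨0, rfl⟩
  have hw : w ∈ hs.extend (Set.subset_univ _) := Module.Basis.subset_extend hs ⟨1, rfl⟩
  have hv' : v' ∈ hs'.extend (Set.subset_univ _) := Module.Basis.subset_extend hs' ⟨0, rfl⟩
  have hw' : w' ∈ hs'.extend (Set.subset_univ _) := Module.Basis.subset_extend hs' ⟨1, rfl⟩
  have hcard : Fintype.card (hs.extend (Set.subset_univ _)) =
      Fintype.card (hs'.extend (Set.subset_univ _)) := by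
    rw [← Module.finrank_eq_card_basis b, ← Module.finrank_eq_card_basis b']
  let x : hs.extend (Set.subset_univ _) := ⟨v, hv⟩
  let y : hs.extend (Set.subset_univ _) := ⟨w, hw⟩
  let x' : hs'.extend (Set.subset_univ _) := ⟨v', hv'⟩
  let y' : hs'.extend (Set.subset_univ _) := ⟨w', hw'⟩
  have hxy : x ≠ y := fun e => hvw (congrArg Subtype.val e)
  have hxy' : x' ≠ y' := fun e => hvw' (congrArg Subtype.val e)
  let e₀ : hs.extend (Set.subset_univ _) ≃ hs'.extend (Set.subset_univ _) :=
    Fintype.equivOfCardEq hcard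
  let e₁ : hs.extend (Set.subset_univ _) ≃ hs'.extend (Set.subset_univ _) :=
    e₀.trans (Equiv.swap (e₀ x) x')
  have he₁x : e₁ x = x' := by simp [e₁]
  let e₂ : hs.extend (Set.subset_univ _) ≃ hs'.extend (Set.subset_univ _) :=
    e₁.trans (Equiv.swap (e₁ y) y')
  have he₂y : e₂ y = y' := by simp [e₂]
  have he₂x : e₂ x = x' := by
    have hne : e₁ x ≠ e₁ y := fun e => hxy (e₁.injective e)
    show Equiv.swap (e₁ y) y' (e₁ x) = x'
    rw [Equiv.swap_apply_of_ne_of_ne hne (he₁x ▸ hxy'), he₁x]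
  have hbx : b x = v := Module.Basis.extend_apply_self hs x
  have hby : b y = w := Module.Basis.extend_apply_self hs y
  obtain ⟨g, hg⟩ := exists_GL_of_linearEquiv (b.equiv b' e₂)
  have h1 : b.equiv b' e₂ (b x) = b' (e₂ x) := by simp
  have h2 : b.equiv b' e₂ (b y) = b' (e₂ y) := by simp
  rw [hbx, he₂x] at h1
  rw [hby, he₂y] at h2
  refine ⟨g, ?_, ?_⟩
  · rw [hg, h1]
    exact Module.Basis.extend_apply_self hs' x'
  · rw [hg, h2]
    exact Module.Basis.extend_apply_self hs' y'

/-! ## The line stabiliser `P` -/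

variable (i₀ : Fin n)

/-- The stabiliser `P` of the line `F e_{i₀}`: `g e_{i₀} ∈ F e_{i₀}` (a maximal parabolic subgroup). -/
def lineStab : Subgroup (GL (Fin n) F) where
  carrier := {g | ∃ a : F, (g : Mat) *ᵥ Pi.single i₀ 1 = a • Pi.single i₀ 1}
  one_mem' := ⟨1, by rw [Units.val_one, Matrix.one_mulVec, one_smul]⟩
  mul_mem' := by
    rintro g h ⟨a, ha⟩ ⟨b, hb⟩
    refine ⟨b * a, ?_⟩
    rw [Units.val_mul, ← Matrix.mulVec_mulVec, hb, Matrix.mulVec_smul, ha, smul_smul]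
  inv_mem' := by
    rintro g ⟨a, ha⟩
    have hne : (Pi.single i₀ (1 : F) : Fin n → F) ≠ 0 := by simp
    have ha0 : a ≠ 0 := by
      rintro rfl
      rw [zero_smul, mulVec_eq_iff, Matrix.mulVec_zero] at ha
      exact hne ha
    have h1 := (mulVec_eq_iff g _ _).mp ha
    rw [Matrix.mulVec_smul] at h1
    exact ⟨a⁻¹, ((inv_smul_eq_iff₀ ha0).mpr h1).symm⟩

local notation "P₀" => lineStab (F := F) i₀
local notation "Q₀" => GL (Fin n) F ⧸ lineStab (F := F) i₀
local notation "q₀" => ((1 : GL (Fin n) F) : GL (Fin n) F ⧸ lineStab (F := F) i₀)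

/-- Membership in `P`, unfolded. -/
theorem mem_lineStab_iff {g : GL (Fin n) F} :
    g ∈ P₀ ↔ ∃ a : F, (g : Mat) *ᵥ Pi.single i₀ 1 = a • Pi.single i₀ 1 := Iff.rfl

/-- `g ∉ P` iff `(e_{i₀}, g e_{i₀})` is linearly independent. -/
theorem not_mem_lineStab_iff {g : GL (Fin n) F} :
    g ∉ P₀ ↔ LinearIndependent F ![Pi.single i₀ 1, (g : Mat) *ᵥ Pi.single i₀ 1] := by
  have hne : (Pi.single i₀ (1 : F) : Fin n → F) ≠ 0 := by simp
  rw [LinearIndependent.pair_iff' hne, mem_lineStab_iff, not_exists]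
  exact forall_congr' fun a => ⟨fun h e => h e.symm, fun h e => h e.symm⟩

/-- An element fixing `e_{i₀}` lies in `P`. -/
theorem mem_lineStab_of_fix {g : GL (Fin n) F} (hg : (g : Mat) *ᵥ Pi.single i₀ 1 = Pi.single i₀ 1) :
    g ∈ P₀ := ⟨1, by rw [hg, one_smul]⟩

/-! ## Cosets `G ⧸ P` (= lines) and the two `P`-orbits -/

/-- Fixed cosets: `y · gP = gP ↔ g⁻¹ y g ∈ P`. -/
theorem smul_coe_eq_iff (y g : GL (Fin n) F) :
    y • (g : Q₀) = (g : Q₀) ↔ g⁻¹ * y * g ∈ P₀ := by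
  rw [MulAction.Quotient.smul_coe, smul_eq_mul, QuotientGroup.eq]
  rw [show (y * g)⁻¹ * g = (g⁻¹ * y * g)⁻¹ by group]
  exact inv_mem_iff

/-- `g⁻¹ y g ∈ P ↔ y (g e_{i₀}) ∈ F (g e_{i₀})`: the coset `gP` is the line through `g e_{i₀}`. -/
theorem conj_mem_lineStab_iff (y g : GL (Fin n) F) :
    g⁻¹ * y * g ∈ P₀ ↔
      ∃ a : F, (y : Mat) *ᵥ ((g : Mat) *ᵥ Pi.single i₀ 1) = a • ((g : Mat) *ᵥ Pi.single i₀ 1) := by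
  rw [mem_lineStab_iff]
  refine exists_congr fun a => ?_
  rw [Units.val_mul, Units.val_mul, ← Matrix.mulVec_mulVec, ← Matrix.mulVec_mulVec]
  constructor
  · intro h
    have := (mulVec_eq_iff g⁻¹ _ _).mp h
    rw [inv_inv, Matrix.mulVec_smul] at this
    exact this
  · intro h
    rw [h, Matrix.mulVec_smul, inv_mulVec_mulVec]

/-- `P` fixes its own coset. -/
theorem smul_base (h : P₀) :
    h • q₀ = q₀ := by
  change (h : GL (Fin n) F) • q₀ = q₀
  rw [smul_coe_eq_iff, mul_one, inv_one, one_mul]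
  exact h.2

/-- `gP = P ↔ g ∈ P`. -/
theorem coe_eq_base_iff (g : GL (Fin n) F) :
    (g : Q₀) = q₀ ↔ g ∈ P₀ := by
  rw [QuotientGroup.eq, mul_one]
  exact inv_mem_iff

/-- **`P` is transitive on the cosets `≠ P`** (i.e. on the lines `≠ F e_{i₀}`). -/
theorem exists_smul_eq [Fintype F] {g g' : GL (Fin n) F} (hg : g ∉ P₀) (hg' : g' ∉ P₀) :
    ∃ h : P₀, h • (g : Q₀) = (g' : Q₀) := by
  rw [not_mem_lineStab_iff] at hg hg'
  obtain ⟨k, hk0, hk1⟩ := exists_GL_pair hg hg'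
  refine ⟨⟨k, mem_lineStab_of_fix i₀ hk0⟩, ?_⟩
  change k • (g : Q₀) = (g' : Q₀)
  rw [MulAction.Quotient.smul_coe, smul_eq_mul, QuotientGroup.eq]
  refine mem_lineStab_of_fix i₀ ?_
  rw [mul_inv_rev, Units.val_mul, Units.val_mul, ← Matrix.mulVec_mulVec, ← Matrix.mulVec_mulVec,
    ← (mulVec_eq_iff k _ _).mp hk1, inv_mulVec_mulVec]

/-- The `P`-orbit of any coset `q ≠ P` is `{q' ≠ P}`. -/
theorem orbit_eq [Fintype F] {q : Q₀}
    (hq : q ≠ q₀) :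
    MulAction.orbit P₀ q = {q' | q' ≠ q₀} := by
  refine Set.ext fun q' => ⟨?_, fun hq' => ?_⟩
  · rintro ⟨h, rfl⟩
    have hback : q = h⁻¹ • ((fun m : P₀ => m • q) h) := (inv_smul_smul h q).symm
    show (fun m : P₀ => m • q) h ≠ q₀
    intro e
    apply hq
    rw [hback, e, smul_base]
  · replace hq' : q' ≠ q₀ := hq'
    induction q using QuotientGroup.induction_on with
    | H g =>
      induction q' using QuotientGroup.induction_on with
      | H g' =>
        have hg : g ∉ P₀ := fun hm => hq ((coe_eq_base_iff i₀ g).mpr hm)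
        have hg' : g' ∉ P₀ := fun hm => hq' ((coe_eq_base_iff i₀ g').mpr hm)
        obtain ⟨h, hh⟩ := exists_smul_eq i₀ hg hg'
        exact ⟨h, hh⟩

/-- For `n ≥ 2` there is a coset `≠ P`. -/
theorem exists_ne_base [Fintype F] (hn : 1 < n) :
    ∃ q : Q₀, q ≠ q₀ := by
  obtain ⟨i₁, hi₁⟩ : ∃ i₁ : Fin n, i₁ ≠ i₀ := by
    by_cases h0 : (i₀ : ℕ) = 0
    · exact ⟨⟨1, hn⟩, fun e => by simp [Fin.ext_iff, h0] at e⟩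
    · exact ⟨⟨0, by omega⟩, fun e => h0 (by rw [← e])⟩
  have hne : (Pi.single i₀ (1 : F) : Fin n → F) ≠ 0 := by simp
  have hne' : (Pi.single i₁ (1 : F) : Fin n → F) ≠ 0 := by simp
  have h01 : LinearIndependent F ![(Pi.single i₀ 1 : Fin n → F), Pi.single i₁ 1] := by
    rw [LinearIndependent.pair_iff' hne]
    intro a e
    have := congr_fun e i₁
    simp [hi₁] at this
  have h10 : LinearIndependent F ![(Pi.single i₁ 1 : Fin n → F), Pi.single i₀ 1] := by
    rw [LinearIndependent.pair_iff' hne']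
    intro a e
    have := congr_fun e i₀
    simp [hi₁.symm] at this
  obtain ⟨g, hg0, -⟩ := exists_GL_pair h01 h10
  refine ⟨g, fun e => ?_⟩
  rw [coe_eq_base_iff, mem_lineStab_iff] at e
  obtain ⟨a, ha⟩ := e
  rw [hg0] at ha
  have := congr_fun ha i₁
  simp [hi₁] at this

/-- **Two `P`-orbits on `G ⧸ P`** (Burnside count): for `n ≥ 2`,
`∑_{h ∈ P} #{q : h q = q} = 2 |P|`. -/
theorem sum_card_fixed [Fintype F] (hn : 1 < n) [Fintype P₀] [Fintype Q₀] [DecidableEq Q₀] :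
    ∑ h : P₀, (Finset.univ.filter fun q : Q₀ => h • q = q).card = 2 * Fintype.card P₀ := by
  classical
  -- swap the double count
  have hswap : ∑ h : P₀, (Finset.univ.filter fun q : Q₀ => h • q = q).card =
      ∑ q : Q₀, (Finset.univ.filter fun h : P₀ => h • q = q).card := by
    simp only [Finset.card_filter]
    exact Finset.sum_comm
  rw [hswap, ← Finset.add_sum_erase Finset.univ _ (Finset.mem_univ q₀)]
  -- the base coset is fixed by all of `P`
  have hbase : (Finset.univ.filter fun h : P₀ => h • q₀ = q₀).card = Fintype.card P₀ := by
    rw [Finset.filter_true_of_mem fun h _ => smul_base i₀ h, Finset.card_univ]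
  rw [hbase, two_mul, add_right_inj]
  -- the other `N - 1` cosets form one orbit: each stabiliser has `|Stab| * (N - 1) = |P|`
  have hN : (Finset.univ.erase q₀).card = Fintype.card Q₀ - 1 := by
    rw [Finset.card_erase_of_mem (Finset.mem_univ _), Finset.card_univ]
  have hN1 : 0 < Fintype.card Q₀ - 1 := by
    obtain ⟨q, hq⟩ := exists_ne_base (F := F) i₀ hn
    rw [← hN]
    exact Finset.card_pos.mpr ⟨q, Finset.mem_erase.mpr ⟨hq, Finset.mem_univ _⟩⟩
  have hstab : ∀ q ∈ Finset.univ.erase q₀,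
      (Finset.univ.filter fun h : P₀ => h • q = q).card * (Fintype.card Q₀ - 1) =
        Fintype.card P₀ := by
    intro q hq
    have hq' : q ≠ q₀ := (Finset.mem_erase.mp hq).1
    have horb : Fintype.card (MulAction.orbit P₀ q) = Fintype.card Q₀ - 1 := by
      rw [Fintype.card_congr (Equiv.setCongr (orbit_eq i₀ hq')), ← hN, ← Set.toFinset_card]
      congr 1
      ext q'
      simp
    have hst : Fintype.card (MulAction.stabilizer P₀ q) =
        (Finset.univ.filter fun h : P₀ => h • q = q).card := by
      rw [← Fintype.card_subtype]
      exact Fintype.card_congr (Equiv.subtypeEquivRight fun h => MulAction.mem_stabilizer_iff)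
    have := MulAction.card_orbit_mul_card_stabilizer_eq_card_group P₀ q
    rw [horb, hst, mul_comm] at this
    exact this
  have hsum : (∑ q ∈ Finset.univ.erase q₀, (Finset.univ.filter fun h : P₀ => h • q = q).card) *
      (Fintype.card Q₀ - 1) = Fintype.card P₀ * (Fintype.card Q₀ - 1) := by
    rw [Finset.sum_mul, Finset.sum_congr rfl hstab, Finset.sum_const, hN, smul_eq_mul, mul_comm]
  exact Nat.eq_of_mul_eq_mul_right hN1 hsum

end LineStabilizer
end Summit.MatrixMultiplication.MatrixMultiplication.Theorems.SubgroupIdentityDesigns.Negative
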